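import Mathlib
import Summits.NavierStokesRegularity.NavierStokesRegularity.Theorems.WakeRatchetTailRatchet.Negative.TailRatchetFalseOfDyadicScalarFronts
import HarnessLib

/-!
# `WakeRatchet.TailRatchet` (stmt-NavierStokesRegularity-21808): the explicit RELAY PROFILE — base point of
# the lacunary-`Λ` continuation programme for the construction item `DyadicScalarFronts`

Support file for the crux `TailRatchet` (route `WakeRatchet`; MODEL lattice ODEs of Tao 2016 §1.2, §4 —
nothing in this file is a statement about the Navier–Stokes equations, and no item is closed here).

The crux is refuted modulo the construction item `WakeRatchetDyadicFront.DyadicScalarFronts`: a real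
function `a` on `t < 0` with
`a'(t) = (Λ/s²) a(t/s)² − (s/Λ) a(t) a(st)`   (`Λ = bigLam ε₀`, some `s > 1`),
integrable on `(−∞,0)`, bounded near `0⁻`, non-trivial, at arbitrarily small `ε₀`.  The second
("drain") term carries the small factor `Λ⁻¹` against the factor `Λ` of the first ("feed") term.  This
file records, sorry-free, the elementary facts that make the DRAIN-FREE equation the natural base point
of a continuation / implicit-function programme in the lacunarity parameter `δ = Λ⁻²` (census of
stmt-21808, programme "R-lac / R-cont"):

* `relay_hasDerivAt_drainFree` — the RELAY PROFILE `a₀(t) = (4/Λ) e^{t}` with time ratio `s = 2` solves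
  the drain-free front equation `a' = (Λ/s²) a(t/s)²` EXACTLY (on all of `ℝ`);
* `relay_hasDerivAt_defect` — it solves the full front equation up to the additive defect
  `(32/Λ³) e^{3t}`, i.e. `a₀' = (Λ/4) a₀(t/2)² − (2/Λ) a₀(t) a₀(2t) + (32/Λ³) e^{3t}`, and
  `relay_drain_eq` / `relay_drain_le` — the drain term is the fraction `(8/Λ²) e^{2t} ≤ 8/Λ²` of `a₀'`
  on `t ≤ 0` (uniformly small on the whole half-line for lacunary `Λ`);
* `relay_integral`, `relay_integrableOn`, `relay_bound`, `relay_ne_zero` — the admissibility data the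
  construction item asks for: `∫_{(−∞,0)} a₀ = 4/Λ`, `0 < a₀ ≤ 4/Λ` on `t ≤ 0`, non-trivial;
* `relay_log_hasDerivAt` — in the self-similar variable `x` (`t = −e^{−x}`) the profile
  `Φ₀(x) = e^{−x} a₀(−e^{−x}) = (4/Λ) e^{−x} exp(−e^{−x})` (a Gumbel density) solves the drain-free
  travelling-wave equation `Φ' = −Φ + Λ Φ(x + log 2)²` with delay `T = log 2`, and
  `relay_log_forward_bound` — its renormalised energy obeys `e^{2x} Φ₀(x)² ≤ (4/Λ)²`;
* THE LINEARISATION at the base point (normalised amplitude `b₀ = e^{t}`, `G(b,s) = b' − (4/s²) b(t/s)²`):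
  `relay_kernel_hasDerivAt` — the scaling mode `h₁(t) = (1+t) e^{t}` solves the linearised pantograph
  equation `h' = 2 e^{t/2} h(t/2)` (`= D_bG(b₀,2) h = 0`), `relay_kernel_is_scaling_mode` — it is
  `∂_c|_{c=1} (c · b₀(ct))`, and `relay_dGds` — the `s`-derivative of `G(b₀, ·)` at `s = 2` is
  `(1 + t/2) e^{t}`.

RECORDED, NOT CLAIMED HERE (paper computation, census of stmt-21808): the adjoint equation
`w' = −4 e^{t} w(2t)`, `w(−∞) = 1`, has the lacunary-series solution `w₁ = Σ_m d_m e^{(2^m−1)t}`,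
`d₀ = 1`, `d_{m+1} = −4 d_m/(2^{m+1} − 1)`, with `w₁(0) = ∏_{i≥1}(1 − 4·2^{−i}) = 0` (Euler) and
`∫_{−∞}^0 w₁ · (1 + t/2) e^{t} = −½ ∏_{i≥1} (1 − 2^{−i}) ≈ −0.1444 ≠ 0`: the bordered linearisation in
`(h, s)` is non-degenerate at `δ = 0`, which is the input an implicit-function construction of dyadic
fronts for lacunary `Λ` needs.  Fronts for lacunary `Λ` do NOT refute `TailRatchet` (which needs
`ε₀ → 0`, i.e. `Λ → 1`); they are the far end of a continuation in `Λ`.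

HONEST FRAMING: elementary calculus; MODEL lattice only; the construction item and the crux stay open.
-/

noncomputable section

set_option linter.dupNamespace false

namespace Summit.NavierStokesRegularity.NavierStokesRegularity.Theorems

namespace WakeRatchetRelayProfile

open MeasureTheory Set Filter Topology Real

/-! ## Elementary exponential identities -/

/-- `e^{t/2}·e^{t/2} = e^{t}`. [folklore] -/
theorem exp_half_sq (t : ℝ) : Real.exp (t / 2) ^ 2 = Real.exp t := by
  rw [sq, ← Real.exp_add]; ring_nf

/-- `e^{t}·e^{2t} = e^{3t}`. [folklore] -/
theorem exp_mul_exp_two (t : ℝ) : Real.exp t * Real.exp (2 * t) = Real.exp (3 * t) := by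
  rw [← Real.exp_add]; ring_nf

/-- `e^{t}·e^{t} = e^{2t}`. [folklore] -/
theorem exp_mul_exp (t : ℝ) : Real.exp t * Real.exp t = Real.exp (2 * t) := by
  rw [← Real.exp_add]; ring_nf

/-! ## The relay profile `a₀(t) = (4/Λ) e^{t}`, `s = 2` -/

/-- Derivative of the relay profile. [folklore] -/
theorem relay_hasDerivAt (Λ t : ℝ) :
    HasDerivAt (fun t : ℝ => 4 / Λ * Real.exp t) (4 / Λ * Real.exp t) t :=
  (Real.hasDerivAt_exp t).const_mul _

/-- **The relay profile solves the drain-free scalar front equation exactly** (time ratio `s = 2`):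
`a₀'(t) = (Λ/s²) a₀(t/s)²` for `a₀(t) = (4/Λ) e^{t}`, on all of `ℝ`.
[cite: Tao2016AveragedNS, §1.2 (dyadic model); cell vocabulary (the scalar front equation of `DyadicScalarFronts` with its drain term dropped)] -/
theorem relay_hasDerivAt_drainFree {Λ : ℝ} (hΛ : Λ ≠ 0) (t : ℝ) :
    HasDerivAt (fun t : ℝ => 4 / Λ * Real.exp t)
      (Λ / (2 : ℝ) ^ 2 * (4 / Λ * Real.exp (t / 2)) ^ 2) t := by
  refine (relay_hasDerivAt Λ t).congr_deriv ?_
  rw [mul_pow, exp_half_sq]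
  field_simp
  ring

/-- The drain term of the relay profile is the fraction `(8/Λ²) e^{2t}` of its derivative:
`(s/Λ) a₀(t) a₀(st) = (8/Λ²) e^{2t} · a₀'(t)` (`s = 2`). [folklore] -/
theorem relay_drain_eq {Λ : ℝ} (hΛ : Λ ≠ 0) (t : ℝ) :
    2 / Λ * (4 / Λ * Real.exp t) * (4 / Λ * Real.exp (2 * t)) =
      8 / Λ ^ 2 * Real.exp (2 * t) * (4 / Λ * Real.exp t) := by
  field_simp
  ring

/-- The drain term of the relay profile equals `(32/Λ³) e^{3t}`. [folklore] -/
theorem relay_drain_eq' {Λ : ℝ} (hΛ : Λ ≠ 0) (t : ℝ) :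
    2 / Λ * (4 / Λ * Real.exp t) * (4 / Λ * Real.exp (2 * t)) = 32 / Λ ^ 3 * Real.exp (3 * t) := by
  rw [← exp_mul_exp_two]
  field_simp
  ring

/-- On the half-line `t ≤ 0` the relative size of the drain term is at most `8/Λ²`:
`(s/Λ) a₀(t) a₀(st) ≤ (8/Λ²) · a₀'(t)` for `Λ > 0`. [folklore] -/
theorem relay_drain_le {Λ : ℝ} (hΛ : 0 < Λ) {t : ℝ} (ht : t ≤ 0) :
    2 / Λ * (4 / Λ * Real.exp t) * (4 / Λ * Real.exp (2 * t)) ≤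
      8 / Λ ^ 2 * (4 / Λ * Real.exp t) := by
  rw [relay_drain_eq hΛ.ne']
  have h1 : Real.exp (2 * t) ≤ 1 := Real.exp_le_one_iff.2 (by linarith)
  have h2 : 0 ≤ 8 / Λ ^ 2 * (4 / Λ * Real.exp t) := by positivity
  calc 8 / Λ ^ 2 * Real.exp (2 * t) * (4 / Λ * Real.exp t)
      = Real.exp (2 * t) * (8 / Λ ^ 2 * (4 / Λ * Real.exp t)) := by ring
    _ ≤ 1 * (8 / Λ ^ 2 * (4 / Λ * Real.exp t)) := mul_le_mul_of_nonneg_right h1 h2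
    _ = 8 / Λ ^ 2 * (4 / Λ * Real.exp t) := one_mul _

/-- **The relay profile solves the FULL scalar front equation of `DyadicScalarFronts` (with `s = 2`) up
to the explicit defect `(32/Λ³) e^{3t}`**:
`a₀'(t) = (Λ/s²) a₀(t/s)² − (s/Λ) a₀(t) a₀(st) + (32/Λ³) e^{3t}`.
[cite: Tao2016AveragedNS, §1.2 (dyadic model); cell vocabulary (`DyadicScalarFronts`)] -/
theorem relay_hasDerivAt_defect {Λ : ℝ} (hΛ : Λ ≠ 0) (t : ℝ) :
    HasDerivAt (fun t : ℝ => 4 / Λ * Real.exp t)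
      (Λ / (2 : ℝ) ^ 2 * (4 / Λ * Real.exp (t / 2)) ^ 2
        - 2 / Λ * (4 / Λ * Real.exp t) * (4 / Λ * Real.exp (2 * t))
        + 32 / Λ ^ 3 * Real.exp (3 * t)) t := by
  refine (relay_hasDerivAt_drainFree hΛ t).congr_deriv ?_
  rw [relay_drain_eq' hΛ]
  ring

/-! ## Admissibility data of the relay profile -/

/-- The relay profile is positive. [folklore] -/
theorem relay_pos {Λ : ℝ} (hΛ : 0 < Λ) (t : ℝ) : 0 < 4 / Λ * Real.exp t := by positivity

/-- The relay profile is bounded by `4/Λ` on `t ≤ 0` (bounded near `0⁻`, as `DyadicScalarFronts` asks).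
[folklore] -/
theorem relay_bound {Λ : ℝ} (hΛ : 0 < Λ) {t : ℝ} (ht : t ≤ 0) : |4 / Λ * Real.exp t| ≤ 4 / Λ := by
  rw [abs_of_pos (relay_pos hΛ t)]
  have h1 : Real.exp t ≤ 1 := Real.exp_le_one_iff.2 ht
  have h2 : 0 ≤ 4 / Λ := by positivity
  calc 4 / Λ * Real.exp t ≤ 4 / Λ * 1 := mul_le_mul_of_nonneg_left h1 h2
    _ = 4 / Λ := mul_one _

/-- The relay profile is non-trivial (non-zero at `t = -1 < 0`). [folklore] -/
theorem relay_ne_zero {Λ : ℝ} (hΛ : 0 < Λ) : ∃ t : ℝ, t < 0 ∧ 4 / Λ * Real.exp t ≠ 0 :=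
  ⟨-1, by norm_num, (relay_pos hΛ _).ne'⟩

/-- `e^{t}` is integrable on `(−∞,0)`. [folklore] -/
theorem integrableOn_exp_Iio_zero : IntegrableOn (fun t : ℝ => Real.exp t) (Iio 0) :=
  (integrableOn_exp_Iic 0).mono_set Iio_subset_Iic_self

/-- `∫_{(−∞,0)} e^{t} dt = 1`. [folklore] -/
theorem integral_exp_Iio_zero : ∫ t in Iio (0 : ℝ), Real.exp t = 1 := by
  rw [← integral_Iic_eq_integral_Iio, integral_exp_Iic_zero]

/-- The relay profile is integrable on `(−∞,0)` (as `DyadicScalarFronts` asks). [folklore] -/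
theorem relay_integrableOn (Λ : ℝ) : IntegrableOn (fun t : ℝ => 4 / Λ * Real.exp t) (Iio 0) :=
  integrableOn_exp_Iio_zero.const_mul _

/-- The action of the relay profile: `∫_{(−∞,0)} a₀ = 4/Λ`. [folklore] -/
theorem relay_integral (Λ : ℝ) : ∫ t in Iio (0 : ℝ), 4 / Λ * Real.exp t = 4 / Λ := by
  rw [integral_const_mul, integral_exp_Iio_zero, mul_one]

/-! ## The relay profile in the self-similar variable: a Gumbel density solving the drain-free
travelling-wave equation with delay `T = log 2` -/

/-- `e^{-(x + log 2)} = e^{-x}/2`. [folklore] -/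
theorem exp_neg_add_log_two (x : ℝ) : Real.exp (-(x + Real.log 2)) = Real.exp (-x) / 2 := by
  rw [neg_add, Real.exp_add, Real.exp_neg (Real.log 2), Real.exp_log two_pos, div_eq_mul_inv]

/-- **Drain-free travelling wave.**  `Φ₀(x) = (4/Λ) e^{-x} exp(-e^{-x})` (`= e^{-x} a₀(-e^{-x})`) solves
`Φ₀' = -Φ₀ + Λ Φ₀(x + log 2)²`: the single-profile travelling-wave equation of the dyadic member in
renormalised variables (damping `1`, feed `Λ`, delay `T = log 2`) with its drain term dropped.
[cite: Tao2016AveragedNS, §1.2 (dyadic model), §4 Lemma 4.1 (4.8) in self-similar variables; cell vocabulary (`IsTW` shape, drain dropped)] -/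
theorem relay_log_hasDerivAt {Λ : ℝ} (hΛ : Λ ≠ 0) (x : ℝ) :
    HasDerivAt (fun x : ℝ => 4 / Λ * Real.exp (-x) * Real.exp (-Real.exp (-x)))
      (-(4 / Λ * Real.exp (-x) * Real.exp (-Real.exp (-x)))
        + Λ * (4 / Λ * Real.exp (-(x + Real.log 2)) * Real.exp (-Real.exp (-(x + Real.log 2)))) ^ 2) x := by
  have hu : HasDerivAt (fun x : ℝ => Real.exp (-x)) (Real.exp (-x) * (-1)) x :=
    (Real.hasDerivAt_exp (-x)).comp x (hasDerivAt_neg x)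
  have hv : HasDerivAt (fun x : ℝ => Real.exp (-Real.exp (-x)))
      (Real.exp (-Real.exp (-x)) * (-(Real.exp (-x) * (-1)))) x :=
    (Real.hasDerivAt_exp _).comp x hu.neg
  have h := (hu.const_mul (4 / Λ)).mul hv
  refine h.congr_deriv ?_
  rw [exp_neg_add_log_two]
  set u := Real.exp (-x) with hu_def
  have hsq : Real.exp (-(u / 2)) ^ 2 = Real.exp (-u) := by
    rw [sq, ← Real.exp_add]; ring_nf
  rw [mul_pow, mul_pow, hsq]
  field_simp
  ring

/-- Forward admissibility of the drain-free wave: `e^{2x} Φ₀(x)² ≤ (4/Λ)²` for all `x`. [folklore] -/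
theorem relay_log_forward_bound (Λ x : ℝ) :
    Real.exp (2 * x) * (4 / Λ * Real.exp (-x) * Real.exp (-Real.exp (-x))) ^ 2 ≤ (4 / Λ) ^ 2 := by
  have h1 : Real.exp (2 * x) * Real.exp (-x) ^ 2 = 1 := by
    rw [sq, ← Real.exp_add, ← Real.exp_add, show 2 * x + (-x + -x) = 0 by ring, Real.exp_zero]
  have h2 : Real.exp (-Real.exp (-x)) ^ 2 ≤ 1 := by
    have h3 : Real.exp (-Real.exp (-x)) ≤ 1 :=
      Real.exp_le_one_iff.2 (neg_nonpos.2 (Real.exp_pos _).le)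
    have h4 : 0 ≤ Real.exp (-Real.exp (-x)) := (Real.exp_pos _).le
    nlinarith
  have h5 : 0 ≤ (4 / Λ) ^ 2 := sq_nonneg _
  calc Real.exp (2 * x) * (4 / Λ * Real.exp (-x) * Real.exp (-Real.exp (-x))) ^ 2
      = (4 / Λ) ^ 2 * (Real.exp (2 * x) * Real.exp (-x) ^ 2) * Real.exp (-Real.exp (-x)) ^ 2 := by ring
    _ = (4 / Λ) ^ 2 * Real.exp (-Real.exp (-x)) ^ 2 := by rw [h1, mul_one]
    _ ≤ (4 / Λ) ^ 2 * 1 := mul_le_mul_of_nonneg_left h2 h5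
    _ = (4 / Λ) ^ 2 := mul_one _

/-! ## The linearisation at the base point

With the normalised amplitude `a = (4/Λ) b` the front equation reads
`G_δ(b,s) := b' − (4/s²) b(t/s)² + 4 s δ · b(t) b(st) = 0`, `δ = Λ⁻²`; the base point is
`(b₀, s₀, δ) = (e^{t}, 2, 0)`.  The derivative of `b ↦ G₀(b,2)` at `b₀` is the pantograph operator
`L₀ h = h' − 2 e^{t/2} h(t/2)` (argument `t/2 ∈ (t,0)`: retarded when read from `0⁻` towards `−∞`). -/

/-- **Kernel of the linearisation: the scaling mode.**  `h₁(t) = (1+t) e^{t}` solves the linearised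
drain-free equation `h' = 2 e^{t/2} h(t/2)` at the relay profile. [folklore] -/
theorem relay_kernel_hasDerivAt (t : ℝ) :
    HasDerivAt (fun t : ℝ => (1 + t) * Real.exp t)
      (2 * Real.exp (t / 2) * ((1 + t / 2) * Real.exp (t / 2))) t := by
  have h := ((hasDerivAt_id' t).const_add 1).mul (Real.hasDerivAt_exp t)
  refine h.congr_deriv ?_
  have hsq : Real.exp (t / 2) * Real.exp (t / 2) = Real.exp t := by
    rw [← Real.exp_add]; ring_nf
  calc 1 * Real.exp t + (1 + t) * Real.exp t = (2 + t) * Real.exp t := by ring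
    _ = (2 + t) * (Real.exp (t / 2) * Real.exp (t / 2)) := by rw [hsq]
    _ = 2 * Real.exp (t / 2) * ((1 + t / 2) * Real.exp (t / 2)) := by ring

/-- The kernel element IS the scaling mode: `h₁ = ∂_c|_{c=1} (c ↦ c · b₀(c t))`, the infinitesimal
generator of the blow-up scaling symmetry `a ↦ c · a(c ·)` of the front equation. [folklore] -/
theorem relay_kernel_is_scaling_mode (t : ℝ) :
    HasDerivAt (fun c : ℝ => c * Real.exp (c * t)) ((1 + t) * Real.exp t) 1 := by
  have h1 : HasDerivAt (fun c : ℝ => c * t) (1 * t) 1 := (hasDerivAt_id' (1 : ℝ)).mul_const t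
  have h2 : HasDerivAt (fun c : ℝ => Real.exp (c * t)) (Real.exp (1 * t) * (1 * t)) 1 := h1.exp
  have h := (hasDerivAt_id' (1 : ℝ)).mul h2
  refine h.congr_deriv ?_
  simp only [one_mul]
  ring

/-- **The bordering direction.**  The `s`-derivative at `s = 2` of `s ↦ G₀(b₀, s)(t) = e^{t} − (4/s²) e^{2t/s}`
is `(1 + t/2) e^{t}`. [folklore] -/
theorem relay_dGds (t : ℝ) :
    HasDerivAt (fun s : ℝ => Real.exp t - 4 / s ^ 2 * Real.exp (2 * t / s))
      ((1 + t / 2) * Real.exp t) 2 := by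
  have h2 : (2 : ℝ) ≠ 0 := two_ne_zero
  have hA : HasDerivAt (fun s : ℝ => 4 / s ^ 2)
      ((0 * (2 : ℝ) ^ 2 - 4 * (((2 : ℕ) : ℝ) * (2 : ℝ) ^ (2 - 1) * 1)) / ((2 : ℝ) ^ 2) ^ 2) 2 :=
    (hasDerivAt_const (2 : ℝ) (4 : ℝ)).div ((hasDerivAt_id' (2 : ℝ)).pow 2) (by norm_num)
  have hB : HasDerivAt (fun s : ℝ => 2 * t / s) ((0 * (2 : ℝ) - 2 * t * 1) / (2 : ℝ) ^ 2) 2 :=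
    (hasDerivAt_const (2 : ℝ) (2 * t)).div (hasDerivAt_id' (2 : ℝ)) h2
  have hC : HasDerivAt (fun s : ℝ => Real.exp (2 * t / s))
      (Real.exp (2 * t / 2) * ((0 * (2 : ℝ) - 2 * t * 1) / (2 : ℝ) ^ 2)) 2 := hB.exp
  have h := (hasDerivAt_const (2 : ℝ) (Real.exp t)).sub (hA.mul hC)
  refine h.congr_deriv ?_
  have ht : 2 * t / 2 = t := by ring
  rw [ht]
  push_cast
  ring

/-! ## Distance to the construction item

`WakeRatchetDyadicFront.DyadicScalarFronts` asks, at arbitrarily small `ε₀`, for `s > 1` and `a` with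
(i) the front ODE on `t < 0`, (ii) `IntegrableOn a (Iio 0)`, (iii) `a` bounded near `0⁻`, (iv) `a`
non-trivial.  The relay profile meets (ii)–(iv) verbatim at EVERY `ε₀ > 0` with `s = 2`, and (i) up to the
defect `(32/Λ³) e^{3t}` — the base point of the continuation, not a witness. -/

open Literature.Analysis.FluidPDE.TaoCascade in
/-- **The relay profile against the clauses of `DyadicScalarFronts`** (`Λ = bigLam ε₀`, `s = 2`): the
front ODE holds with the additive defect `(32/Λ³)e^{3t}`, and the three admissibility clauses hold
exactly.  (Not a witness of the construction item: the defect is non-zero at every `ε₀`.)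
[cite: Tao2016AveragedNS, §1.2 (dyadic model); cell vocabulary (`DyadicScalarFronts`, `bigLam`)] -/
theorem relay_dyadicScalarFronts_clauses {ε₀ : ℝ} (hε : 0 < ε₀) :
    (∀ t : ℝ, t < 0 → HasDerivAt (fun t : ℝ => 4 / bigLam ε₀ * Real.exp t)
      (bigLam ε₀ / (2 : ℝ) ^ 2 * (4 / bigLam ε₀ * Real.exp (t / 2)) ^ 2
        - 2 / bigLam ε₀ * (4 / bigLam ε₀ * Real.exp t) * (4 / bigLam ε₀ * Real.exp (2 * t))
        + 32 / bigLam ε₀ ^ 3 * Real.exp (3 * t)) t) ∧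
    IntegrableOn (fun t : ℝ => 4 / bigLam ε₀ * Real.exp t) (Iio 0) ∧
    (∃ t₀ : ℝ, t₀ < 0 ∧ ∃ P : ℝ, ∀ t : ℝ, t₀ ≤ t → t < 0 → |4 / bigLam ε₀ * Real.exp t| ≤ P) ∧
    ∃ t : ℝ, t < 0 ∧ 4 / bigLam ε₀ * Real.exp t ≠ 0 := by
  have hΛ : 0 < bigLam ε₀ := bigLam_pos (by linarith)
  exact ⟨fun t _ => relay_hasDerivAt_defect hΛ.ne' t, relay_integrableOn _,
    ⟨-1, by norm_num, 4 / bigLam ε₀, fun t _ ht => relay_bound hΛ ht.le⟩, relay_ne_zero hΛ⟩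

end WakeRatchetRelayProfile

end Summit.NavierStokesRegularity.NavierStokesRegularity.Theorems

end
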